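import Literature.Topology.FourManifolds.SimplifiedBrokenLefschetzFibrationProofs
import Literature.Topology.FourManifolds.CobordismMorseFunctions
import Literature.Topology.FourManifolds.MorseEulerEqualities
import Literature.Topology.FourManifolds.MorseTurnAbout
import Literature.Topology.FourManifolds.ClosedAsCobordism
import Literature.Topology.FourManifolds.RegularLevelSet
import Literature.AlgebraicTopology.Homotopy.FibreBundlesCellEuler
import Literature.AlgebraicTopology.SingularHomology.EulerCharacteristicTriple
import HarnessLib

/-!
# Euler characteristics of the pole pieces of a broken Lefschetz fibration

Topic `Literature/Topology/FourManifolds`; infrastructure for the Euler count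
`card_eq_four_mul_of_sblf_of_homotopyEquiv_sphere_four` (Baykur 2012, Lemma 7: *"the Euler
characteristic of* `X` *can be also computed as the sum* `e(X) = 2 - 2(g-1) + 2 - 2g + k`*"*) of
`SimplifiedBrokenLefschetzFibration.lean`.  Everything here is **proved**; no definitions, no
named facts.

* `finRelHomology_and_relEuler_eq_zero_of_even` — **a closed manifold of odd dimension has
  `χ = 0`** (with finiteness of `H_•(·; ℤ)`): the Morse count of a Morse function `F` of the
  cobordism `(Y; ∅, ∅)` (Milnor 1965, Thm. 2.5, §3, Thm. 7.4) equals that of `1 - F`, whose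
  index-`k` critical points are the index-`(dim Y - k)` critical points of `F` (proof of
  Thm. 9.1), so `χ(Y) = -χ(Y)`.
* `finRelHomology_and_relEuler_level` — hence a regular level of a smooth function on a closed
  `4`-manifold (a closed `3`-manifold, Hirsch 1976, Ch. 1 Thm. 3.2) has `χ = 0`.

## References

* R. İ. Baykur, *Broken Lefschetz fibrations and smooth structures on 4-manifolds*,
  Geom. Topol. Monogr. 18 (2012), Lemma 7. [Baykur2012]
* J. Milnor, *Lectures on the h-cobordism theorem* (1965), Thm. 2.5, §3, Thm. 7.4, proof of
  Thm. 9.1. [MilnorHCobordism1965]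
* M. W. Hirsch, *Differential Topology* (1976), Ch. 1 §3, Thm. 3.2. [HirschDT1976]
-/

noncomputable section

open scoped Manifold ContDiff Topology unitInterval
open Set Function Filter
open Literature.AlgebraicTopology.SingularHomology

namespace Literature.Topology.FourManifolds

universe u

/-! ### Closed manifolds of odd dimension have `χ = 0` -/

section Odd

variable {n : ℕ} {Y : Type u} [TopologicalSpace Y] [T2Space Y] [SecondCountableTopology Y]
  [CompactSpace Y] [ChartedSpace (EuclideanSpace ℝ (Fin (n + 1))) Y] [IsManifold (𝓡 (n + 1)) ∞ Y]

/-- `(-1)^(2m+1-k) = -(-1)^k` for `k ≤ 2m + 1`. [folklore] -/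
private theorem neg_one_pow_odd_sub {m k : ℕ} (hk : k ≤ m + m + 1) :
    (-1 : ℤ) ^ (m + m + 1 - k) = -(-1 : ℤ) ^ k := by
  have h3 : m + m + 1 - k + k = 2 * m + 1 := by omega
  have h4 : (-1 : ℤ) ^ (m + m + 1 - k) * (-1 : ℤ) ^ k = -1 := by
    rw [← pow_add, h3, pow_succ, pow_mul]; norm_num
  have h5 : (-1 : ℤ) ^ k * (-1 : ℤ) ^ k = 1 := by
    rw [← pow_add, ← two_mul, pow_mul]; norm_num
  calc (-1 : ℤ) ^ (m + m + 1 - k)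
      = (-1 : ℤ) ^ (m + m + 1 - k) * ((-1 : ℤ) ^ k * (-1 : ℤ) ^ k) := by rw [h5, mul_one]
    _ = ((-1 : ℤ) ^ (m + m + 1 - k) * (-1 : ℤ) ^ k) * (-1 : ℤ) ^ k := by ring
    _ = -(-1 : ℤ) ^ k := by rw [h4]; ring

/-- **A closed manifold of odd dimension `n + 1` has Euler characteristic `0`**, and its integral
homology is finitely generated and vanishes from degree `n + 2` on.  Morse-theoretic proof
(Milnor 1965): a Morse function `F` of the cobordism `(Y; ∅, ∅)` (Thm. 2.5) has
`χ(Y) = Σₖ (-1)ᵏ #critₖ(F)` (§3, Thm. 7.4), and so has `1 - F`, whose critical points of index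
`k` are those of `F` of index `n + 1 - k` (proof of Thm. 9.1); for `n + 1` odd the two counts
are opposite. [cite: MilnorHCobordism1965, Thm. 2.5, §3 (PDF p. 21), Thm. 7.4, proof of Thm. 9.1] -/
theorem finRelHomology_and_relEuler_eq_zero_of_even (hn : Even n) :
    FinRelHomology ℤ ℤ Y ∅ (n + 2) ∧ relEuler ℤ ℤ Y ∅ = 0 := by
  obtain ⟨F, hF⟩ := (Cobordism.ofClosed n Y).exists_isMorseFunction_of
  obtain ⟨hfin, -⟩ := hF.finRelHomology ℤ ℤ
  have hχ := hF.relEuler_eq_sum_ncard ℤ ℤ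
  have hχ' : relEuler ℤ ℤ (Cobordism.ofClosed n Y).W (range (Cobordism.ofClosed n Y).inr) =
      (∑ k ∈ Finset.range (n + 2), (-1 : ℤ) ^ k *
        ((criticalSetOfIndex (𝓡∂ (n + 1)) (fun z => 1 - F z) k).ncard : ℤ)) *
          Module.finrank ℤ ℤ :=
    hF.symm.relEuler_eq_sum_ncard ℤ ℤ
  rw [Module.finrank_self, Nat.cast_one, mul_one] at hχ hχ'
  have h1 : range (Cobordism.ofClosed n Y).inl = (∅ : Set (Cobordism.ofClosed n Y).W) :=
    Set.range_eq_empty _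
  have h2 : range (Cobordism.ofClosed n Y).inr = (∅ : Set (Cobordism.ofClosed n Y).W) :=
    Set.range_eq_empty _
  rw [h1] at hχ hfin
  rw [h2] at hχ'
  -- the count of `1 - F` is minus the count of `F`
  have hflip : ∀ k ∈ Finset.range (n + 2),
      ((criticalSetOfIndex (𝓡∂ (n + 1)) (fun z => 1 - F z) k).ncard : ℤ) =
        ((criticalSetOfIndex (𝓡∂ (n + 1)) F (n + 1 - k)).ncard : ℤ) := fun k hk => by
    rw [hF.criticalSetOfIndex_one_sub (by have := Finset.mem_range.1 hk; omega)]
  have hsum : ∑ k ∈ Finset.range (n + 2), (-1 : ℤ) ^ k *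
      ((criticalSetOfIndex (𝓡∂ (n + 1)) (fun z => 1 - F z) k).ncard : ℤ) =
      -(∑ k ∈ Finset.range (n + 2), (-1 : ℤ) ^ k *
        ((criticalSetOfIndex (𝓡∂ (n + 1)) F k).ncard : ℤ)) := by
    rw [Finset.sum_congr rfl fun k hk => by rw [hflip k hk]]
    rw [← Finset.sum_range_reflect (fun k => (-1 : ℤ) ^ k *
      ((criticalSetOfIndex (𝓡∂ (n + 1)) F k).ncard : ℤ)) (n + 2), ← Finset.sum_neg_distrib]
    refine Finset.sum_congr rfl fun k hk => ?_
    have hidx : n + 2 - 1 - k = n + 1 - k := by omega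
    rw [hidx]
    obtain ⟨m, rfl⟩ := hn
    rw [neg_one_pow_odd_sub (by have := Finset.mem_range.1 hk; omega)]
    ring
  have hzero : relEuler ℤ ℤ (Cobordism.ofClosed n Y).W ∅ = 0 := by
    linarith [hχ, hχ', hsum]
  -- transfer along the identity `Y → HalfSpaceCharted Y`
  let e : Y ≃ₜ HalfSpaceCharted Y :=
    { toEquiv := HalfSpaceCharted.of
      continuous_toFun := continuous_id
      continuous_invFun := continuous_id }
  have hfin' : FinRelHomology ℤ ℤ (HalfSpaceCharted Y) ∅ (n + 2) := hfin
  have hzero' : relEuler ℤ ℤ (HalfSpaceCharted Y) ∅ = 0 := hzero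
  refine ⟨hfin'.of_homeomorph e.symm (mapsTo_empty _ _) (mapsTo_empty _ _), ?_⟩
  rw [relEuler_eq_of_homeomorph (R := ℤ) (M := ℤ) (A := (∅ : Set Y)) e (mapsTo_empty _ _)
    (mapsTo_empty _ _)]
  exact hzero'

end Odd

/-! ### Regular levels in a closed `4`-manifold -/

section Level

variable {X : Type u} [TopologicalSpace X] [T2Space X] [SecondCountableTopology X]
  [CompactSpace X] [ChartedSpace (EuclideanSpace ℝ (Fin 4)) X] [IsManifold (𝓡 4) ∞ X]

/-- **A regular level of a smooth function on a closed `4`-manifold has `χ = 0`** (it is a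
closed `3`-manifold, Hirsch 1976, Ch. 1 Thm. 3.2 — the tree's `RegularLevel` — and
`finRelHomology_and_relEuler_eq_zero_of_even` applies), with finiteness of its homology.
[cite: HirschDT1976, Ch. 1 §3, Thm. 3.2] [cite: MilnorHCobordism1965, proof of Thm. 9.1] -/
theorem finRelHomology_and_relEuler_level {g : X → ℝ} (hg : ContMDiff (𝓡 4) 𝓘(ℝ, ℝ) ∞ g)
    {a : ℝ} (hreg : ∀ x, g x = a → ¬ IsMCriticalPt (𝓡 4) g x) :
    FinRelHomology ℤ ℤ ↥(g ⁻¹' {a}) ∅ 4 ∧ relEuler ℤ ℤ ↥(g ⁻¹' {a}) ∅ = 0 := by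
  have h : IsRegularLevel (𝓡 4) g a :=
    ⟨hg, fun x _ => BoundarylessManifold.isInteriorPoint, fun x hx => hreg x hx⟩
  exact finRelHomology_and_relEuler_eq_zero_of_even (n := 2) (Y := RegularLevel h) even_two

end Level

/-! ### Caps of the sphere cut out by a linear height -/

section Caps

open Literature.AlgebraicTopology.Homotopy

/-- **The open caps `{v ∈ S² | b < Λ v}` (`Λ` linear, `b ≥ 0`) are preconnected**: the cap is
the radial image of the convex cone-like region `{x | b ‖x‖ < Λ x}` of `ℝ³`. [folklore] -/
theorem isPreconnected_setOf_lt_apply_sphere (Λ : EuclideanSpace ℝ (Fin 3) →L[ℝ] ℝ) {b : ℝ} (hb : 0 ≤ b) :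
    IsPreconnected {v : (Metric.sphere (0 : EuclideanSpace ℝ (Fin 3)) 1) | b < Λ v} := by
  set C : Set (EuclideanSpace ℝ (Fin 3)) := {x | b * ‖x‖ < Λ x} with hC
  have hconv : Convex ℝ C := by
    intro x hx y hy s t hs ht hst
    show b * ‖s • x + t • y‖ < Λ (s • x + t • y)
    rw [map_add, map_smul, map_smul, smul_eq_mul, smul_eq_mul]
    have h1 : ‖s • x + t • y‖ ≤ s * ‖x‖ + t * ‖y‖ := by
      refine (norm_add_le _ _).trans ?_
      rw [norm_smul, norm_smul, Real.norm_of_nonneg hs, Real.norm_of_nonneg ht]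
    have h2 : b * ‖s • x + t • y‖ ≤ s * (b * ‖x‖) + t * (b * ‖y‖) := by
      have := mul_le_mul_of_nonneg_left h1 hb
      linarith
    have hx' : s * (b * ‖x‖) ≤ s * Λ x := mul_le_mul_of_nonneg_left (le_of_lt hx) hs
    have hy' : t * (b * ‖y‖) ≤ t * Λ y := mul_le_mul_of_nonneg_left (le_of_lt hy) ht
    by_cases hs0 : s = 0
    · subst hs0
      rw [zero_add] at hst
      subst hst
      have : (1 : ℝ) * (b * ‖y‖) < 1 * Λ y := by rw [one_mul, one_mul]; exact hy
      linarith
    · have hs' : 0 < s := lt_of_le_of_ne hs (Ne.symm hs0)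
      have hx'' : s * (b * ‖x‖) < s * Λ x := mul_lt_mul_of_pos_left hx hs'
      linarith
  have hC0 : ∀ x ∈ C, x ≠ 0 := by
    rintro x hx rfl
    simp [hC] at hx
  have hN : ContinuousOn (fun x : EuclideanSpace ℝ (Fin 3) => ‖x‖⁻¹ • x) C :=
    ((continuousOn_id.norm).inv₀ fun x hx => (norm_pos_iff.2 (hC0 x hx)).ne').smul
      continuousOn_id
  have himage : (Subtype.val '' {v : (Metric.sphere (0 : EuclideanSpace ℝ (Fin 3)) 1) | b < Λ v}) =
      (fun x : EuclideanSpace ℝ (Fin 3) => ‖x‖⁻¹ • x) '' C := by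
    ext y
    constructor
    · rintro ⟨v, hv, rfl⟩
      have hv1 : ‖(v : EuclideanSpace ℝ (Fin 3))‖ = 1 := norm_eq_of_mem_sphere v
      refine ⟨(v : EuclideanSpace ℝ (Fin 3)), ?_, ?_⟩
      · show b * ‖(v : EuclideanSpace ℝ (Fin 3))‖ < Λ v
        rw [hv1, mul_one]; exact hv
      · show ‖(v : EuclideanSpace ℝ (Fin 3))‖⁻¹ • (v : EuclideanSpace ℝ (Fin 3)) = v
        rw [hv1, inv_one, one_smul]
    · rintro ⟨x, hx, rfl⟩
      have hx0 : 0 < ‖x‖ := norm_pos_iff.2 (hC0 x hx)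
      have hmem : ‖x‖⁻¹ • x ∈ (Metric.sphere (0 : EuclideanSpace ℝ (Fin 3)) 1) := by
        rw [mem_sphere_zero_iff_norm, norm_smul, norm_inv, norm_norm, inv_mul_cancel₀ hx0.ne']
      refine ⟨⟨_, hmem⟩, ?_, rfl⟩
      show b < Λ (‖x‖⁻¹ • x)
      rw [map_smul, smul_eq_mul, ← div_eq_inv_mul, lt_div_iff₀ hx0]
      exact hx
  rw [← Topology.IsInducing.subtypeVal.isPreconnected_image, himage]
  exact hconv.isPreconnected.image _ hN

/-- **A closed cap `{v ∈ S² | b ≤ Λ v}` with `b > 0` strongly deformation retracts onto any of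
its points `w`**, inside any subspace `U₀ ⊇ cap` of the sphere: the homotopy is the straight
segment from `v` to `w` followed by renormalisation (along it `Λ ≥ b` and the norm is `≤ 1`, so
the renormalised point stays in the cap). [folklore] -/
theorem isStrongDeformationRetractOf_singleton_cap (Λ : EuclideanSpace ℝ (Fin 3) →L[ℝ] ℝ) {b : ℝ}
    (hb : 0 < b) {U₀ : Set (Metric.sphere (0 : EuclideanSpace ℝ (Fin 3)) 1)}
    (hTU : {v : (Metric.sphere (0 : EuclideanSpace ℝ (Fin 3)) 1) | b ≤ Λ v} ⊆ U₀)
    {w : (Metric.sphere (0 : EuclideanSpace ℝ (Fin 3)) 1)} (hw : b ≤ Λ w) :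
    IsStrongDeformationRetractOf ({⟨w, hTU hw⟩} : Set ↥U₀)
      (Subtype.val ⁻¹' {v : (Metric.sphere (0 : EuclideanSpace ℝ (Fin 3)) 1) | b ≤ Λ v}) := by
  -- the segment and its renormalisation, on vectors
  have hseg : ∀ t : ℝ, 0 ≤ t → t ≤ 1 → ∀ v : EuclideanSpace ℝ (Fin 3), ‖v‖ = 1 → b ≤ Λ v →
      b ≤ Λ ((1 - t) • v + t • (w : EuclideanSpace ℝ (Fin 3))) ∧
        ‖(1 - t) • v + t • (w : EuclideanSpace ℝ (Fin 3))‖ ≤ 1 := by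
    intro t ht0 ht1 v hv hbv
    constructor
    · rw [map_add, map_smul, map_smul, smul_eq_mul, smul_eq_mul]
      nlinarith
    · calc ‖(1 - t) • v + t • (w : EuclideanSpace ℝ (Fin 3))‖
          ≤ ‖(1 - t) • v‖ + ‖t • (w : EuclideanSpace ℝ (Fin 3))‖ := norm_add_le _ _
        _ = (1 - t) + t := by
          rw [norm_smul, norm_smul, Real.norm_of_nonneg (by linarith), Real.norm_of_nonneg ht0,
            hv, norm_eq_of_mem_sphere w, mul_one, mul_one]
        _ = 1 := by ring
  have hren : ∀ x : EuclideanSpace ℝ (Fin 3), b ≤ Λ x → ‖x‖ ≤ 1 →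
      ‖x‖⁻¹ • x ∈ (Metric.sphere (0 : EuclideanSpace ℝ (Fin 3)) 1) ∧ b ≤ Λ (‖x‖⁻¹ • x) := by
    intro x hbx hx1
    have hx0 : x ≠ 0 := by
      rintro rfl
      rw [map_zero] at hbx
      linarith
    have hpos : 0 < ‖x‖ := norm_pos_iff.2 hx0
    constructor
    · rw [mem_sphere_zero_iff_norm, norm_smul, norm_inv, norm_norm, inv_mul_cancel₀ hpos.ne']
    · rw [map_smul, smul_eq_mul]
      have h1 : 1 ≤ ‖x‖⁻¹ := (one_le_inv₀ hpos).2 hx1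
      have h2 : 0 ≤ Λ x := hb.le.trans hbx
      calc b ≤ Λ x := hbx
        _ = 1 * Λ x := (one_mul _).symm
        _ ≤ ‖x‖⁻¹ * Λ x := mul_le_mul_of_nonneg_right h1 h2
  -- the homotopy
  set T' : Set ↥U₀ :=
    Subtype.val ⁻¹' {v : (Metric.sphere (0 : EuclideanSpace ℝ (Fin 3)) 1) | b ≤ Λ v} with hT'
  set seg : I × ↥T' → EuclideanSpace ℝ (Fin 3) := fun p =>
    (1 - (p.1 : ℝ)) • (((p.2 : ↥U₀) : (Metric.sphere (0 : EuclideanSpace ℝ (Fin 3)) 1)) : EuclideanSpace ℝ (Fin 3)) +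
      (p.1 : ℝ) • (w : EuclideanSpace ℝ (Fin 3)) with hsegdef
  have hseg' : ∀ p : I × ↥T', b ≤ Λ (seg p) ∧ ‖seg p‖ ≤ 1 := fun p =>
    hseg _ p.1.2.1 p.1.2.2 _ (norm_eq_of_mem_sphere _) p.2.2
  have hren' : ∀ p : I × ↥T',
      ‖seg p‖⁻¹ • seg p ∈ (Metric.sphere (0 : EuclideanSpace ℝ (Fin 3)) 1) ∧ b ≤ Λ (‖seg p‖⁻¹ • seg p) := fun p =>
    hren _ (hseg' p).1 (hseg' p).2
  have hcont_seg : Continuous seg := by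
    refine Continuous.add ?_ ?_
    · exact (continuous_const.sub (continuous_subtype_val.comp continuous_fst)).smul
        (continuous_subtype_val.comp (continuous_subtype_val.comp
          (continuous_subtype_val.comp continuous_snd)))
    · exact (continuous_subtype_val.comp continuous_fst).smul continuous_const
  have hpos : ∀ p : I × ↥T', ‖seg p‖ ≠ 0 := fun p h => by
    have h1 := (hseg' p).1
    rw [norm_eq_zero] at h
    rw [h, map_zero] at h1
    linarith
  have hcont : Continuous fun p : I × ↥T' => ‖seg p‖⁻¹ • seg p :=
    (hcont_seg.norm.inv₀ hpos).smul hcont_seg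
  let H : C(I × ↥T', ↥T') :=
    ⟨fun p => ⟨⟨⟨‖seg p‖⁻¹ • seg p, (hren' p).1⟩, hTU (hren' p).2⟩, (hren' p).2⟩,
      ((hcont.subtype_mk fun p => (hren' p).1).subtype_mk fun p => hTU (hren' p).2).subtype_mk
        fun p => (hren' p).2⟩
  have hH : ∀ p : I × ↥T',
      ((((H p : ↥T') : ↥U₀) : (Metric.sphere (0 : EuclideanSpace ℝ (Fin 3)) 1)) : EuclideanSpace ℝ (Fin 3)) = ‖seg p‖⁻¹ • seg p :=
    fun p => rfl
  -- at a point where the segment is constant `= v` with `‖v‖ = 1` the homotopy fixes `v`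
  have hfix : ∀ p : I × ↥T',
      seg p = (((p.2 : ↥U₀) : (Metric.sphere (0 : EuclideanSpace ℝ (Fin 3)) 1)) : EuclideanSpace ℝ (Fin 3)) → H p = p.2 := by
    intro p hp
    apply Subtype.ext; apply Subtype.ext; apply Subtype.ext
    rw [hH, hp, norm_eq_of_mem_sphere, inv_one, one_smul]
  refine ⟨H, fun z => hfix (0, z) ?_, fun z => ?_, fun t z hz => hfix (t, z) ?_⟩
  · simp [hsegdef]
  · show ((H (1, z) : ↥T') : ↥U₀) ∈ ({⟨w, hTU hw⟩} : Set ↥U₀)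
    rw [mem_singleton_iff]
    apply Subtype.ext; apply Subtype.ext
    show ‖seg (1, z)‖⁻¹ • seg (1, z) = (w : EuclideanSpace ℝ (Fin 3))
    have : seg (1, z) = (w : EuclideanSpace ℝ (Fin 3)) := by simp [hsegdef]
    rw [this, norm_eq_of_mem_sphere, inv_one, one_smul]
  · have hz' : ((z : ↥U₀) : (Metric.sphere (0 : EuclideanSpace ℝ (Fin 3)) 1)) = w :=
      congrArg Subtype.val (mem_singleton_iff.1 hz)
    simp only [hsegdef, hz']
    rw [← add_smul]
    simp

/-! ### Over a cap of regular values the total space has the Euler characteristic of the fibre -/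

variable {X : Type u} [TopologicalSpace X] [T2Space X] [SecondCountableTopology X]
  [CompactSpace X] [ChartedSpace (EuclideanSpace ℝ (Fin 4)) X] [IsManifold (𝓡 4) ∞ X]
  {f : X → (Metric.sphere (0 : EuclideanSpace ℝ (Fin 3)) 1)}

/-- **Over a subset `T` of regular values which strongly deformation retracts to a point `w`,
`χ(f⁻¹T) = χ(f⁻¹w)`**, with finiteness: `f` is a fibre bundle over the open preconnected set
`U₀ ⊇ T` of regular values (Ehresmann, `isFibreBundleWith_restrictPreimage`); the inclusion
`f⁻¹w ↪ f⁻¹T` is a weak homotopy equivalence (Spanier 1981, Ch. 9 Sec. 2 Thm. 17), so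
`H_•(f⁻¹T, f⁻¹w) = 0` (Ch. 7 Sec. 6 Thm. 25, the tree's
`IsFibreBundleWith.isZero_relativeSingularHomology_preimage`), and the exact sequence of the
pair gives `χ(f⁻¹T) = χ(f⁻¹w) + 0` (Hatcher 2002, Thm. 2.44).
[cite: Spanier1981, Ch. 9, Sec. 2, Thm. 17 and Ch. 7, Sec. 6, Thm. 25]
[cite: HatcherAT2002, §2.2 Thm. 2.44] -/
theorem finRelHomology_and_relEuler_preimage_of_isStrongDeformationRetractOf
    (hf : ContMDiff (𝓡 4) (𝓡 2) ∞ f) {U₀ : Set (Metric.sphere (0 : EuclideanSpace ℝ (Fin 3)) 1)}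
    (hU₀o : IsOpen U₀) (hU₀c : IsPreconnected U₀)
    (hU₀ : ∀ y ∈ U₀, ∀ q, f q = y → Surjective (mfderiv (𝓡 4) (𝓡 2) f q))
    {T : Set (Metric.sphere (0 : EuclideanSpace ℝ (Fin 3)) 1)} (hTU : T ⊆ U₀)
    {w : (Metric.sphere (0 : EuclideanSpace ℝ (Fin 3)) 1)} (hwT : w ∈ T)
    (hret : IsStrongDeformationRetractOf ({⟨w, hTU hwT⟩} : Set ↥U₀) (Subtype.val ⁻¹' T))
    {N : ℕ} (hF : FinRelHomology ℤ ℤ ↥(f ⁻¹' {w}) ∅ N) :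
    FinRelHomology ℤ ℤ ↥(f ⁻¹' T) ∅ N ∧
      relEuler ℤ ℤ ↥(f ⁻¹' T) ∅ = relEuler ℤ ℤ ↥(f ⁻¹' {w}) ∅ := by
  set p : ↥(f ⁻¹' U₀) → ↥U₀ := U₀.restrictPreimage f with hpdef
  have hp : IsFibreBundleWith ↥(f ⁻¹' {w}) p :=
    isFibreBundleWith_restrictPreimage hf hU₀o hU₀c hU₀ (hTU hwT)
  set S : Set ↥U₀ := {⟨w, hTU hwT⟩} with hS
  set T' : Set ↥U₀ := Subtype.val ⁻¹' T with hT'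
  have hST : S ⊆ T' := by
    intro z hz
    rw [hS, mem_singleton_iff] at hz
    rw [hz]
    exact hwT
  have hweq := isWeakHomotopyEquiv_subsetInclusion_of_isStrongDeformationRetractOf hret hST
  have hzero : ∀ i, CategoryTheory.Limits.IsZero
      (relativeSingularHomology ℤ ℤ ↥(p ⁻¹' T') (Subtype.val ⁻¹' (p ⁻¹' S)) i) := fun i =>
    hp.isZero_relativeSingularHomology_preimage hST hweq ℤ i
  have hPA : FinRelHomology ℤ ℤ ↥(p ⁻¹' T') (Subtype.val ⁻¹' (p ⁻¹' S)) N :=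
    (FinRelHomology.of_isZero hzero).mono (Nat.zero_le N)
  have hχPA : relEuler ℤ ℤ ↥(p ⁻¹' T') (Subtype.val ⁻¹' (p ⁻¹' S)) = 0 :=
    relEuler_eq_zero_of_isZero hzero
  -- the fibre over `w` inside `p⁻¹ T'`
  have hmemS : ∀ z : ↥(p ⁻¹' T'), z ∈ (Subtype.val ⁻¹' (p ⁻¹' S) : Set ↥(p ⁻¹' T')) ↔
      f ((z : ↥(f ⁻¹' U₀)) : X) = w := by
    intro z
    simp only [mem_preimage, hS, mem_singleton_iff, hpdef]
    constructor
    · intro h; exact congrArg Subtype.val h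
    · intro h; exact Subtype.ext h
  have hwU : ∀ x : ↥(f ⁻¹' {w}), f (x : X) ∈ U₀ := fun x => by
    rw [show f (x : X) = w from x.2]; exact hTU hwT
  have hwT' : ∀ x : ↥(f ⁻¹' {w}), (⟨(x : X), hwU x⟩ : ↥(f ⁻¹' U₀)) ∈ p ⁻¹' T' := fun x => by
    show f (x : X) ∈ T
    rw [show f (x : X) = w from x.2]; exact hwT
  let eA : ↥(Subtype.val ⁻¹' (p ⁻¹' S) : Set ↥(p ⁻¹' T')) ≃ₜ ↥(f ⁻¹' {w}) :=
    { toFun := fun z => ⟨((z.1 : ↥(f ⁻¹' U₀)) : X), (hmemS z.1).1 z.2⟩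
      invFun := fun x => ⟨⟨⟨(x : X), hwU x⟩, hwT' x⟩, (hmemS _).2 x.2⟩
      left_inv := fun z => rfl
      right_inv := fun x => rfl
      continuous_toFun := by fun_prop
      continuous_invFun := by fun_prop }
  have hA : FinRelHomology ℤ ℤ ↥(Subtype.val ⁻¹' (p ⁻¹' S) : Set ↥(p ⁻¹' T'))
      (Subtype.val ⁻¹' (∅ : Set ↥(p ⁻¹' T'))) N := by
    rw [Set.preimage_empty]
    exact hF.of_homeomorph eA.symm (mapsTo_empty _ _) (mapsTo_empty _ _)
  obtain ⟨hP, hχP⟩ := FinRelHomology.triple_mid (empty_subset _) hA hPA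
  -- transport to `f⁻¹ T`
  let eP : ↥(p ⁻¹' T') ≃ₜ ↥(f ⁻¹' T) :=
    { toFun := fun z => ⟨((z : ↥(f ⁻¹' U₀)) : X), z.2⟩
      invFun := fun x => ⟨⟨(x : X), hTU x.2⟩, x.2⟩
      left_inv := fun z => rfl
      right_inv := fun x => rfl
      continuous_toFun := by fun_prop
      continuous_invFun := by fun_prop }
  refine ⟨hP.of_homeomorph eP (mapsTo_empty _ _) (mapsTo_empty _ _), ?_⟩
  rw [← relEuler_eq_of_homeomorph (R := ℤ) (M := ℤ) (A := (∅ : Set ↥(p ⁻¹' T'))) eP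
    (mapsTo_empty _ _) (mapsTo_empty _ _), hχP, hχPA, add_zero, Set.preimage_empty,
    relEuler_eq_of_homeomorph (R := ℤ) (M := ℤ) (A := (∅ : Set _)) eA
      (mapsTo_empty _ _) (mapsTo_empty _ _)]

/-- **Over a closed cap `{b ≤ Λ}` of regular values the total space has the Euler
characteristic of any of its fibres** (Baykur 2012, proof of Lemma 7: *"disk neighborhoods of*
[the two poles] *… where the latter two are regular fibers"*): if all values `v` with
`b' < Λ v` are regular (`0 ≤ b' < b`) and `b ≤ Λ w`, then `H_•(f⁻¹{b ≤ Λ}; ℤ)` is finitely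
generated and bounded like `H_•(f⁻¹w)`, and `χ(f⁻¹{b ≤ Λ}) = χ(f⁻¹w)`. [cite: Baykur2012, Lemma 7]
[cite: Spanier1981, Ch. 9, Sec. 2, Thm. 17 and Ch. 7, Sec. 6, Thm. 25] -/
theorem finRelHomology_and_relEuler_preimage_cap (hf : ContMDiff (𝓡 4) (𝓡 2) ∞ f)
    (Λ : EuclideanSpace ℝ (Fin 3) →L[ℝ] ℝ) {b' b : ℝ} (hb' : 0 ≤ b') (hb : b' < b)
    (hreg : ∀ v : (Metric.sphere (0 : EuclideanSpace ℝ (Fin 3)) 1), b' < Λ v → ∀ q, f q = v →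
      Surjective (mfderiv (𝓡 4) (𝓡 2) f q))
    {w : (Metric.sphere (0 : EuclideanSpace ℝ (Fin 3)) 1)} (hw : b ≤ Λ w) {N : ℕ}
    (hF : FinRelHomology ℤ ℤ ↥(f ⁻¹' {w}) ∅ N) :
    FinRelHomology ℤ ℤ ↥(f ⁻¹' {v : (Metric.sphere (0 : EuclideanSpace ℝ (Fin 3)) 1) | b ≤ Λ v}) ∅ N ∧
      relEuler ℤ ℤ ↥(f ⁻¹' {v : (Metric.sphere (0 : EuclideanSpace ℝ (Fin 3)) 1) | b ≤ Λ v}) ∅ =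
        relEuler ℤ ℤ ↥(f ⁻¹' {w}) ∅ := by
  have hU₀o : IsOpen {v : (Metric.sphere (0 : EuclideanSpace ℝ (Fin 3)) 1) | b' < Λ v} :=
    isOpen_lt continuous_const (Λ.continuous.comp continuous_subtype_val)
  have hTU : {v : (Metric.sphere (0 : EuclideanSpace ℝ (Fin 3)) 1) | b ≤ Λ v} ⊆
      {v : (Metric.sphere (0 : EuclideanSpace ℝ (Fin 3)) 1) | b' < Λ v} := fun v hv => lt_of_lt_of_le hb hv
  exact finRelHomology_and_relEuler_preimage_of_isStrongDeformationRetractOf hf hU₀o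
    (isPreconnected_setOf_lt_apply_sphere Λ hb') (fun v hv => hreg v hv) hTU hw
    (isStrongDeformationRetractOf_singleton_cap Λ (hb'.trans_lt hb) hTU hw) hF

end Caps

end Literature.Topology.FourManifolds
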